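import Summits.QuantumFields.YangMills.Theses.PencilRigidity
import Summits.QuantumFields.YangMills.Theorems.CurvatureBoostCovariance.Negative.Unbundled
import Summits.QuantumFields.YangMills.Theorems.NPointIsotropy.Negative.ModelBlindFalse
import HarnessLib.Audit

/-!
# Line `quarter-turn-corner-operator` — checked skeleton for crux `PencilRigidity.NPointIsotropy`
(stmt-QuantumFields-11686; crux-plan, round 1; planner-cruxplan-stmt-QuantumFields-11686-quarter-turn-corner--0)

Idea (card `Ideas/quarter-turn-corner-operator.md`): the diagonal mirror `x⁰ = x¹` is the axis mirror `x⁰ = 0`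
followed by the hypercubic quarter-turn `Rq : e₀ ↦ e₁, e₁ ↦ -e₀` (a symmetry the crux HAS), so diagonal reflection
positivity read in the `e₀`-quantisation makes `P : [G] ↦ [Rq·G]` a POSITIVE SYMMETRIC operator on quadrant vectors
(`G` supported in `Q = {x⁰ > 0 > x¹}`) of the `e₀`-Osterwalder–Schrader space — the continuum corner transfer
operator.  The crux is the statement that the fractional powers of its positive self-adjoint extension `A` act
geometrically; by ONE-ANGLE AMPLIFICATION it is enough that the positive SQUARE ROOT is the eighth-turn:
`A^{1/2}[G] = [R_{π/4}·G]`, i.e. (polarised, distribution level) the `EighthTurnIdentity` below.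

Shape (junk-proof; the answer to `Theorems/NPointIsotropy/Negative/ModelBlindFalse.not_NPointIsotropyModelBlind` and
`Negative/TieLoadBearing`): the Wilson tie is consumed ONCE, by `stub_tieRegularity` (every `𝔖ₙ|⁰𝒮` of a tied family is a
function — the `n`-point analogue of crux #4 `CurvatureKernelBound`, without a rate; cf. the disprover's
`NPointIsotropyRegularModelBlind`, Disproof.lean §7b); every later stub is MODEL-BLIND but carries `NPointRegular`
(and/or unordered reflection positivity), which the junk family `𝔖₄ = J` violates, so no stub is an instance of a landed
Negative lemma.  Composition `NPointIsotropy_of` is sorry-free; sorries live only in `stub_*`.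

Stubs (6): A `stub_tieRegularity` (tie ⇒ regularity) · B `stub_regularUnorderedRP` (regularity upgrades the ordered
16-frame E2 to the Glimm–Jaffe/`𝒮₊` form on `⁰𝒮`) · C `stub_planarSpectralCone` (= `MirrorModularBoosts.PlanarSpectralCone`,
shared item stmt-QuantumFields-9664, delegated) · D `stub_eighthTurnIdentity` (THE BET: corner operator, Borchers
commutation, radial pin, `A^{1/2}` geometric) · E `stub_eighthTurnPropagation` (identity on corner-split tests ⇒
`R_{π/4}`-invariance on `⁰𝒮`, by analytic continuation in diagonal group shifts) · F `stub_oneAngleAmplification`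
(`⟨W(B₄)⁺, R_{π/4}⟩` is dense in `SO(4)`; invariance groups of tempered families are closed).

Conventions. `Rq (x⁰,x¹) = (-x¹, x⁰)` (`Rq e₀ = e₁`, `Rq e₁ = -e₀`), `R₈` = rotation by `+π/4` (`R₈² = Rq`),
`θ₀ ∘ Rq` = swap of coordinates `0,1` = the diagonal mirror, `Q = {x⁰ > 0 > x¹}` (so `Rq Q = {x⁰, x¹ > 0}` and
`R₈ Q ⊂ {x⁰ > 0}`).  Vocabulary `W1, OSPackage, Translations, Hypercubic, Gaps, EightFrameRP, PlanarInvariant` is the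
landed unbundling of `Theorems/CurvatureBoostCovariance/Negative/Unbundled.lean` (the crux is definitionally
`∀ G …, W1 r sch S₁ → EightFrameRP S₁ → RadialKernel S₁ → PlanarInvariant S₁`, `crux_iff` below).
-/

noncomputable section

namespace Summit.QuantumFields.YangMills.Cruxes.NPointIsotropy.QuarterTurnCornerOperator

open scoped BigOperators SchwartzMap
open MeasureTheory Filter Topology
open Literature.MathematicalPhysics.QuantumLattice Literature.MathematicalPhysics.AQFT
  Literature.MathematicalPhysics.QuantumFieldTheory
open Summit.QuantumFields.YangMills.Theorems.CurvatureBoostCovariance.Negative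
  (OSPackage Translations Hypercubic EightFrameRP PlanarInvariant Tie Gaps W1)

local notation "E" => EuclideanSpace ℝ (Fin 4)

/-! ## §0 Vocabulary (definitions only; no sorry) -/

/-- The radial-kernel hypothesis of the crux (verbatim its third antecedent). -/
def RadialKernel (S : SchwingerFamily E) : Prop :=
  ∃ K : E → ℝ, ContinuousOn K {x : E | x ≠ 0} ∧ (∀ (R : E ≃ₗᵢ[ℝ] E) (x : E), x ≠ 0 → K (R x) = K x) ∧
    ∀ F : 𝓢((Fin 2 → E), ℂ), IsOffDiagonal F →
      MeasureTheory.Integrable (fun x : Fin 2 → E => (K (x 0 - x 1) : ℂ) * F x) ∧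
      S 2 F = ∫ x : Fin 2 → E, (K (x 0 - x 1) : ℂ) * F x

/-- **`n`-point regularity** (the junk-killer the Wilson tie must supply): every `𝔖ₙ` restricted to `⁰𝒮` is
integration against a function `Wₙ` (automatically locally integrable off the coincidence locus).  The `n`-point,
rate-free analogue of crux #4 `CurvatureKernelBound`; cf. the continuity clause of the disprover's
`NPointIsotropyRegularModelBlind` (Disproof.lean §7b), of which this is the `L¹` weakening. -/
def NPointRegular (S : SchwingerFamily E) : Prop :=
  ∀ n : ℕ, ∃ W : (Fin n → E) → ℂ, ∀ F : 𝓢((Fin n → E), ℂ), IsOffDiagonal F →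
    MeasureTheory.Integrable (fun x : Fin n → E => W x * F x) ∧ S n F = ∫ x : Fin n → E, W x * F x

/-- **Unordered reflection positivity on `⁰𝒮`** along `e₀` (Osterwalder–Schrader's `𝒮₊` / Glimm–Jaffe §6.1 form,
restricted to OFF-DIAGONAL positive-time test functions so that only `𝔖|⁰𝒮` and `𝔖₀` are read): for every finite
sequence `F₀, F₁, …` of positive-time-SUPPORTED (not necessarily time-ordered) off-diagonal test functions,
`∑ₙₘ 𝔖ₙ₊ₘ(ΘFₙ* ⊗ Fₘ) ≥ 0`.  The tree's E2 (`IsReflectionPositive`) asks this only for time-ORDERED `Fₙ`; the junk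
family satisfies the ordered form in all sixteen frames and violates this one. -/
def UnorderedRP (S : SchwingerFamily E) : Prop :=
  ∀ (N : ℕ) (F : (n : ℕ) → 𝓢((Fin n → E), ℂ)),
    (∀ n, N < n → F n = 0) → (∀ n, IsPositiveTimeMulti (F n)) → (∀ n, IsOffDiagonal (F n)) →
      ∀ H : (n m : ℕ) → 𝓢((Fin (n + m) → E), ℂ),
        (∀ n m, IsAppendTensorOf (H n m) (osAdjoint (F n)) (F m)) →
          let z := ∑ n ∈ Finset.range (N + 1), ∑ m ∈ Finset.range (N + 1), S (n + m) (H n m)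
          0 ≤ z.re ∧ z.im = 0

/-- Unordered reflection positivity on `⁰𝒮` in pull-back form for the EIGHT planar frames (time axis
`a e₀ + b e₁`, `a² + b² = 1`, `a = 0 ∨ b = 0 ∨ a² = b²`) — by proper hypercubic transport, across all sixteen
`W(B₄)` mirrors. -/
def EightFrameUnorderedRP (S : SchwingerFamily E) : Prop :=
  ∀ (R : E ≃ₗᵢ[ℝ] E) (a b : ℝ), a ^ 2 + b ^ 2 = 1 → (a = 0 ∨ b = 0 ∨ a ^ 2 = b ^ 2) →
    R (EuclideanSpace.single 0 1) = a • EuclideanSpace.single 0 1 + b • EuclideanSpace.single 1 1 →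
      UnorderedRP (fun n => (S n).comp (linActMulti R))

/-- `Rq` is THE hypercubic quarter-turn of the `(x⁰,x¹)`-plane: `e₀ ↦ e₁`, `e₁ ↦ -e₀`, `e₂, e₃` fixed
(`Rq (x⁰,x¹) = (-x¹, x⁰)`; `θ₀ ∘ Rq` = the diagonal mirror `x⁰ ↔ x¹`). -/
def IsQuarterTurn (R : E ≃ₗᵢ[ℝ] E) : Prop :=
  R (EuclideanSpace.single 0 1) = EuclideanSpace.single 1 1 ∧
    R (EuclideanSpace.single 1 1) = -EuclideanSpace.single 0 1 ∧
    R (EuclideanSpace.single 2 1) = EuclideanSpace.single 2 1 ∧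
    R (EuclideanSpace.single 3 1) = EuclideanSpace.single 3 1

/-- `R₈` is THE eighth-turn of the `(x⁰,x¹)`-plane (rotation by `+π/4`, `R₈² = Rq`):
`e₀ ↦ (e₀ + e₁)/√2`, `e₁ ↦ (-e₀ + e₁)/√2`, `e₂, e₃` fixed. -/
def IsEighthTurn (R : E ≃ₗᵢ[ℝ] E) : Prop :=
  R (EuclideanSpace.single 0 1) =
      (Real.sqrt 2 / 2) • EuclideanSpace.single 0 1 + (Real.sqrt 2 / 2) • EuclideanSpace.single 1 1 ∧
    R (EuclideanSpace.single 1 1) =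
      -((Real.sqrt 2 / 2) • EuclideanSpace.single 0 1) + (Real.sqrt 2 / 2) • EuclideanSpace.single 1 1 ∧
    R (EuclideanSpace.single 2 1) = EuclideanSpace.single 2 1 ∧
    R (EuclideanSpace.single 3 1) = EuclideanSpace.single 3 1

/-- Support in the open quadrant `Q = {x⁰ > 0 > x¹}` of the `(x⁰,x¹)`-plane, every point (`Q ⊂ {x⁰ > x¹}`, the
positive side of the diagonal mirror; `Rq Q = {x⁰ > 0, x¹ > 0}` and `R₈ Q` stay in the half-space `{x⁰ > 0}`). -/
def IsQuadrantSupported {n : ℕ} (G : 𝓢((Fin n → E), ℂ)) : Prop :=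
  tsupport (G : (Fin n → E) → ℂ) ⊆ {x | ∀ i, 0 < x i 0 ∧ x i 1 < 0}

/-- **The eighth-turn identity** ("the positive square root of the corner operator is the eighth-turn",
polarised, at distribution level): for quadrant-supported off-diagonal `G₁` (`m` points) and `G₂` (`n` points),
`𝔖ₘ₊ₙ(Θ(R₈·G₁)* ⊗ R₈·G₂) = 𝔖ₘ₊ₙ(ΘG₁* ⊗ Rq·G₂)`, i.e. `⟨A^{1/2}[G₁], A^{1/2}[G₂]⟩ = ⟨[G₁], A[G₂]⟩` with
`A^{1/2} ↔ R₈`, `A ↔ Rq`.  A consequence of planar rotation invariance (`Θ(R₈G₁)*⊗R₈G₂ = R₈⁻¹·(ΘG₁*⊗RqG₂)`), hence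
no stronger than the crux; the test functions are NOT required to be time-ordered. -/
def EighthTurnIdentity (S : SchwingerFamily E) : Prop :=
  ∀ (Rq R₈ : E ≃ₗᵢ[ℝ] E), IsQuarterTurn Rq → IsEighthTurn R₈ →
    ∀ (m n : ℕ) (G₁ : 𝓢((Fin m → E), ℂ)) (G₂ : 𝓢((Fin n → E), ℂ)),
      IsQuadrantSupported G₁ → IsQuadrantSupported G₂ → IsOffDiagonal G₁ → IsOffDiagonal G₂ →
        ∀ (H H' : 𝓢((Fin (m + n) → E), ℂ)),
          IsAppendTensorOf H (osAdjoint (linActMulti R₈ G₁)) (linActMulti R₈ G₂) →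
          IsAppendTensorOf H' (osAdjoint G₁) (linActMulti Rq G₂) →
            S (m + n) H = S (m + n) H'

/-- Invariance on `⁰𝒮` under the single rotation `R₈` by `π/4` (all `n`). -/
def EighthTurnInvariant (S : SchwingerFamily E) : Prop :=
  ∀ R₈ : E ≃ₗᵢ[ℝ] E, IsEighthTurn R₈ →
    ∀ (n : ℕ) (F : 𝓢((Fin n → E), ℂ)), IsOffDiagonal F → S n (linActMulti R₈ F) = S n F

/-- The crux, unbundled (definitional; same as the disprover's `Disproof.crux_iff`). -/
theorem crux_iff :
    Summit.QuantumFields.YangMills.Theses.PencilRigidity.NPointIsotropy ↔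
      ∀ (G : Type) [Group G] [TopologicalSpace G] [IsTopologicalGroup G] [CompactSpace G],
        IsCompactSimpleLieGroup G →
        letI : MeasurableSpace G := borel G
        haveI : BorelSpace G := ⟨rfl⟩
        ∀ (r : LatticeRep G) (sch : SpeciesScheme (YMSpecies G)) (S₁ : SchwingerFamily E),
          W1 r sch S₁ → EightFrameRP S₁ → RadialKernel S₁ → PlanarInvariant S₁ :=
  Iff.rfl

/-! ## §1 The stubs -/

/-- **Stub A (the tie consumer; size: property-of-the-limit, like crux #4).** For a one-species family carrying the
curvature package `W₁` of a Wilson scaling limit (tie + OS package + translations + proper hypercubic invariance +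
gaps), with the eight planar frames and the radial two-point kernel, every `𝔖ₙ|⁰𝒮` is a FUNCTION.  This is the ONLY
place the lattice clause enters (it must: `Negative.ModelBlindFalse`, `Negative.TieLoadBearing`); it is the `n`-point,
rate-free analogue of `CurvatureKernelBound` (which gives exactly this at `n = 2`), excludes the junk family
(`𝔖₄ = J` charges a Lebesgue-null 7-plane family), and holds for every certified inhabitant of `W₁` (zero scheme:
`𝔖ₙ|⁰𝒮 = 0`; `β_k = 0` frequently: c-number field).  Why plausibly true: a convergent Wilson limit of the
`tr F²` strings with OS package and gap is expected to have real-analytic Schwinger functions off coincidences;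
a singular limit needs `c_k` amplification that destroys temperedness at shorter distances (Disproof §7a). -/
theorem stub_tieRegularity :
    ∀ (G : Type) [Group G] [TopologicalSpace G] [IsTopologicalGroup G] [CompactSpace G],
      IsCompactSimpleLieGroup G →
      letI : MeasurableSpace G := borel G
      haveI : BorelSpace G := ⟨rfl⟩
      ∀ (r : LatticeRep G) (sch : SpeciesScheme (YMSpecies G)) (S₁ : SchwingerFamily E),
        W1 r sch S₁ → EightFrameRP S₁ → RadialKernel S₁ → NPointRegular S₁ := by
  sorry

/-- **Stub B (regularity ⇒ unordered sixteen-frame E2 on `⁰𝒮`; size M, provable now).** With every `𝔖ₙ|⁰𝒮` a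
function, the ordered (OS 1973) reflection positivity of the eight pulled-back families upgrades to the unordered
`𝒮₊` form: a positive-time off-diagonal `F` straddling equal-time walls is the `L¹`-limit (against the locally
integrable `W₂ₙ` on the compact support of `ΘF*⊗F ⊂ (coincidence locus)ᶜ`) of test functions supported off the
walls, which E3 (`IsSymmetric`) re-orders into time-ordered ones; positivity passes to the limit; degree `0` by E0.
False without `NPointRegular` (junk), true with it. Feeds the positivity of the corner operator on ALL quadrant
vectors (stub D) and the OS vectors of unordered groups (stub E). -/
theorem stub_regularUnorderedRP :
    ∀ S : SchwingerFamily E, OSPackage S → Translations S → Hypercubic S → EightFrameRP S →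
      NPointRegular S → EightFrameUnorderedRP S := by
  sorry

/-- **Stub C (the planar spectral cone; = shared item stmt-QuantumFields-9664 VERBATIM, delegated to its own seat).**
Model-blind: E0' + E3 + translations + E2 in the eight planar frames ⇒ `⟨Ψ_F, e^{-ζH + iβP₁} Ψ_G⟩` is holomorphic on
`{|Im β| < Re ζ}` with the contraction bound (`spec(H,P₁) ⊂ {E ≥ |p₁|}`).  Consumed by stub D (Friedrichs
extension on a dense domain, Borchers commutation) and stub E (analyticity in diagonal group shifts), applied to `S`
and to its diagonal pull-backs (whose eight frames are the same eight frames). -/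
theorem stub_planarSpectralCone :
    Summit.QuantumFields.YangMills.Theses.MirrorModularBoosts.PlanarSpectralCone := by
  sorry

/-- **Stub D — THE BET (size XL): the positive square root of the corner operator is the eighth-turn.**
Line inside: (1) `P[G] := [Rq·G]` on quadrant vectors of the `e₀`-OS space is symmetric (Rq-invariance,
`θ₀Rqθ₀ = Rq⁻¹`) and positive (`θ₀∘Rq` = diagonal mirror; unordered diagonal E2 from stub B) — the card's first
lemma, provable now; (2) quadrant vectors are dense (Reeh–Schlieder in the `(t,x¹)`-tube from the cone, stub C), so the
Friedrichs extension `A ≥ 0` (Mathlib has no Friedrichs extension: work with the closed form) is densely defined and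
self-adjoint; (3) Borchers-type commutation from `P T(b) ⊂ T(Rq b) P` + the cone: `A^{is} T(b) A^{-is} = T(Λ(πs/2) b)`
(the merged card `quarter-turn-root`'s transfer C⁺: the roots NORMALISE the translation group; spectrum-level Lorentz
invariance drops out); (4) radial pin: on one-field vectors `A^{is} = e^{-is(π/2)L₁}` (Källén–Lehmann from `RadialKernel`,
Klein–Landau uniqueness of the local symmetric semigroup); (5) the bet: `A^{1/2}[G] = [R₈·G]` (four-quadrant KMS cycle /
Baxter's corner identity `A = Δ_R^{-1/4}`, exact on every lattice approximant; or Pusz–Woronowicz: the diagonal form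
`𝔖(θ_dG₁*⊗G₂) = ⟨G₁, AG₂⟩` is the geometric mean of the `e₀`-form and its quarter-turned copy, and the claim is that the Gram
form of the eighth-turned vectors is that same mean), whose polarisation is the conclusion.  Honest status: open both ways
below the typed hypotheses (GaierYngvason2000: boost covariance is two-point data only for generalised free fields); implied
by planar invariance, so not refutable short of the regular model-blind statement itself; junk-proof through
`NPointRegular`/`EightFrameUnorderedRP`.  Cheapest falsifier: massive free field, two-particle quadrant wave packets — is
`⟨[R₈G₁],[R₈G₂]⟩ = ⟨[G₁],[RqG₂]⟩`, i.e. is `Γ(q)^{1/2}` the eighth-turn (it must be; and for the coned anisotropic Gaussian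
`Ĉ = (1+εe₂²)/(p²+m²)` it must NOT be)? -/
theorem stub_eighthTurnIdentity :
    ∀ S : SchwingerFamily E, OSPackage S → Translations S → Hypercubic S →
      (∃ Δ : ℝ, 0 < Δ ∧ S.toLabelled.HasMassGap Δ) → EightFrameRP S → RadialKernel S →
      NPointRegular S → EightFrameUnorderedRP S →
      Summit.QuantumFields.YangMills.Theses.MirrorModularBoosts.PlanarSpectralCone →
        EighthTurnIdentity S := by
  sorry

/-- **Stub E (corner-split identity ⇒ `R₈`-invariance on all of `⁰𝒮`; size L, provable now modulo OS machinery).**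
Since `Θ(R₈G₁)*⊗R₈G₂ = R₈⁻¹·(ΘG₁*⊗RqG₂)`, the identity says `S_{R₈⁻¹}(H') = S(H')` for the PULLED-BACK family
`S_{R₈⁻¹} := S ∘ linActMulti R₈⁻¹` (itself one of the eight frames: `R₈⁻¹e₀ = (e₀-e₁)/√2`) on every test `H'` whose
configuration is NE-corner-split (one group below-left, the other above-right of a common corner; translations move the
corner), i.e. `∫ Wₙ(R₈x)Φ(x)dx = ∫ WₙΦ` there.  For a.e. configuration (unique lowest-time point `p`, the rest `h` at times
`> p⁰`, unordered) put `T_b := Θg̃* ⊗ τ_{b(e₀+e₁)/√2} h`: `b ↦ S(T_b)` and `b ↦ S_{R₈⁻¹}(T_b)` are BOTH restrictions of the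
planar-cone functions `Φ(b/√2 + t₀, b/√2)` of stub C — applied to `S` and to `S_{R₈⁻¹}` (same E0', E3, translations, and the
SAME eight frames, rotated by 45°), extended to the unordered group `h` by stub B + `NPointRegular` — hence real-analytic on
`(-ε, ∞)`; they agree for `b ≫ 0` (the shifted configuration is NE-corner-split), hence at `b = 0`.  Tensor density then gives
`Wₙ∘R₈ = Wₙ` a.e. (`n ≥ 2`; `n = 1`: a translation-invariant `L¹_loc` function is a.e. constant), i.e. invariance on `⁰𝒮`.
No model-blind mop-up over the exceptional set `𝔈ₙ` is claimed: everything is an a.e. statement about the representing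
functions (`NPointRegular`), which is exactly what the junk theorem demands. -/
theorem stub_eighthTurnPropagation :
    ∀ S : SchwingerFamily E, OSPackage S → Translations S → Hypercubic S → EightFrameRP S →
      NPointRegular S → EightFrameUnorderedRP S →
      Summit.QuantumFields.YangMills.Theses.MirrorModularBoosts.PlanarSpectralCone →
        EighthTurnIdentity S → EighthTurnInvariant S := by
  sorry

/-- **Stub F — one-angle amplification (pure group theory + continuity; size M, provable now).** Invariance on `⁰𝒮`
under the proper signed permutations `W(B₄) ∩ SO(4)` and under ONE rotation by `π/4` forces invariance under every
determinant-one isometry fixing `e₂, e₃` (indeed under all of `SO(4)`): `⟨W(B₄)⁺, R₈⟩` is infinite (its image in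
either `SO(3)` factor contains the binary-octahedral image and an element outside it, and `2O` is maximal finite),
its closure has a nonzero `W(B₄)⁺`-invariant Lie algebra, `so(4) = Λ²₊ ⊕ Λ²₋` with each summand
`W(B₄)⁺`-irreducible and the two summands exchanged by nothing proper but linked through `R₈ = [e^{iπ/8}, e^{-iπ/8}]`,
so the closure is `SO(4)`; and the invariance group of a tempered family on `⁰𝒮` is CLOSED (`R ↦ linActMulti R F` is
continuous into `𝓢`).  Junk-proof: the junk family is not `R₈`-invariant (`ModelBlindFalse`: `J(R_θF₀) = 0` for
`θ ∈ (1/2, 1) ∋ π/4`). -/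
theorem stub_oneAngleAmplification :
    ∀ S : SchwingerFamily E, Hypercubic S → EighthTurnInvariant S → PlanarInvariant S := by
  sorry

/-! ## §2 The composition (kernel-checked, sorry-free): the six stubs prove the crux BY NAME -/

/-- **`NPointIsotropy` from the six stubs.**  Tie ⇒ regularity (A); regularity ⇒ unordered sixteen-frame E2 (B);
cone (C); corner operator ⇒ eighth-turn identity (D); propagation to `R₈`-invariance on `⁰𝒮` (E); one-angle
amplification ⇒ every planar rotation (F). -/
theorem NPointIsotropy_of : Summit.QuantumFields.YangMills.Theses.PencilRigidity.NPointIsotropy := by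
  rw [crux_iff]
  intro G _ _ _ _ hG r sch S₁ hW h8 hK
  have hreg : NPointRegular S₁ := stub_tieRegularity G hG r sch S₁ hW h8 hK
  obtain ⟨-, hOS, htr, hhyp, hgaps⟩ := hW
  have hgap : ∃ Δ : ℝ, 0 < Δ ∧ S₁.toLabelled.HasMassGap Δ := hgaps.imp fun Δ hΔ => ⟨hΔ.1, hΔ.2.1⟩
  have hurp : EightFrameUnorderedRP S₁ := stub_regularUnorderedRP S₁ hOS htr hhyp h8 hreg
  have hcone : Summit.QuantumFields.YangMills.Theses.MirrorModularBoosts.PlanarSpectralCone :=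
    stub_planarSpectralCone
  have h8th : EighthTurnIdentity S₁ :=
    stub_eighthTurnIdentity S₁ hOS htr hhyp hgap h8 hK hreg hurp hcone
  have hinv : EighthTurnInvariant S₁ :=
    stub_eighthTurnPropagation S₁ hOS htr hhyp h8 hreg hurp hcone h8th
  exact stub_oneAngleAmplification S₁ hhyp hinv

end Summit.QuantumFields.YangMills.Cruxes.NPointIsotropy.QuarterTurnCornerOperator

end
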